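import Literature.Probability.LatticeModels.PolymerPushforward
import HarnessLib

/-!
# Local perturbations of a finite-range dependent reference process: the polymer gas

`Literature/Probability/LatticeModels/`. The probabilistic form of the high-temperature /
small-activity (Mayer) expansion (Friedli–Velenik 2017 §5.2 and §5.7.1; Seiler LNP 159 Ch. 2–3;
for finite-range Gaussian references Brydges–Guadagni–Mitter 2004 §2 and
Bauerschmidt–Brydges–Slade 2019 §3.3, "the finite-range property implies factorisation"):

**Setting.** A probability space `(Ω, μ)`; a family of *cells* `p : V` with a symmetric
adjacency `R` (so that `Touches R K₁ K₂` — sharing a cell or containing adjacent cells — is the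
geometric incompatibility of `PolymerGasGeometric`); a sub-σ-algebra `𝓕 p` of events
"determined near the cell `p`"; and the **finite-range dependence** hypothesis

  `¬ Touches R K₁ K₂ → Indep (⨆ p ∈ K₁, 𝓕 p) (⨆ p ∈ K₂, 𝓕 p) μ`

(cell sets that do not touch generate independent σ-algebras — a product reference measure with
cells = finite sets of sites, `IsLocalPerturbation.indep_of_iIndep`; or a Gaussian field with a
finite-range covariance with cells = blocks). A *local perturbation* is a family of cell factors
`g p : Ω → ℂ`, `𝓕 p`-measurable, with `‖g p‖ ≤ ε` (`IsLocalPerturbation`). The perturbed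
partition functions and the cell-set activities are

  `pertZ μ g C = ∫ ∏_{p ∈ C} (1 + g p) dμ`,  `cellActivity μ g K = ∫ ∏_{p ∈ K} g p dμ`.

**Results (all proved).**
* `pertZ_eq_sum_cellActivity`: `Z(C) = Σ_{K ⊆ C} M(K)` (expand the product);
* `cellActivity_union`: `M(K₁ ∪ K₂) = M(K₁) M(K₂)` for non-touching `K₁, K₂` (independence), and
  `norm_cellActivity_le`: `‖M(K)‖ ≤ ε^{#K}`;
* `pertZ_eq_polymerPartitionFunction`: **`Z(C)` is the partition function of the hard-core gas
  of nonempty `R`-connected subsets of `C`** with activity `M` and the geometric incompatibility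
  (the tree's `sum_powerset_eq_polymerPartitionFunction_of_mul`);
* under Dobrushin's smallness condition `e ε (Δ + 1)² ≤ 1/2` (`Δ` bounds the number of
  neighbours of a cell; the tree's `geomInc_dobrushin`): **zero-freeness** `pertZ_ne_zero`
  (`Z(C) ≠ 0` for every finite `C`) and the **volume-uniform exclusion cost**
  `norm_pertZ_sdiff_div_le`: `‖Z(C ∖ D) / Z(C)‖ ≤ exp (2 e ε (Δ + 1) #D)`;
* (in `LocalPerturbationPositivity`) **positivity for real data**: if all activities `M(K)`,
  `K ⊆ C`, are real then `Z(C)` is real and `> 0` (intermediate value theorem along `t ↦ t • g`).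

These are the uniform-in-volume inputs of convergent expansions around a non-product reference
(one renormalisation-group step with a finite-range fluctuation covariance; the last,
one-dimensional stage of a multiscale expansion). The expectation of local observables is treated
in the companion file `LocalPerturbationObservables`.

## Mathlib / tree anchors

`ProbabilityTheory.Indep`, `indep_of_indep_of_le_left/right`, `IndepFun_iff_Indep`,
`IndepFun.integral_mul_eq_mul_integral`, `indep_iSup_of_disjoint`, `Finset.prod_one_add`,
`integral_finset_sum`, `Integrable.of_bound`; tree: `Touches`, `GeomInc`, `IsRConnected`,
`kpWeight`, `geomInc_dobrushin`, `sum_kpWeight_le_of_touches` (`PolymerGasGeometric`),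
`polymerPartitionFunction_ne_zero_and_ratio_le`, `norm_polymerPartitionFunction_sdiff_div_le_exp`
(`PolymerGas`), `sum_powerset_eq_polymerPartitionFunction_of_mul`, `cellSupp`, `ShareVertex`,
`disjoint_cellSupp_of_not_touches` (`PolymerPushforward`).

## References

* S. Friedli, Y. Velenik, *Statistical Mechanics of Lattice Systems*, CUP (2017), §5.2
  (polymer representation), Thm. 5.4, §5.7.1 (high-temperature expansion). [FriedliVelenik2017]
* E. Seiler, *Gauge Theories as a Problem of Constructive Quantum Field Theory and Statistical
  Mechanics*, LNP 159 (1982), Ch. 2–3. [SeilerLNP1982]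
* R. L. Dobrushin, *Estimates of semi-invariants for the Ising model at low temperatures*, AMS
  Transl. (2) 177 (1996) 59–81. [Dobrushin1996]
* D. Brydges, G. Guadagni, P. K. Mitter, *Finite range decomposition of Gaussian processes*,
  J. Stat. Phys. 115 (2004) 415–449, §2. [BrydgesGuadagniMitter2004]
* R. Bauerschmidt, D. Brydges, G. Slade, *Introduction to a Renormalisation Group Method*,
  LNM 2242 (2019), §3.3. [BauerschmidtBrydgesSlade2019]
-/

noncomputable section

open _root_.MeasureTheory _root_.ProbabilityTheory Finset
open scoped BigOperators

namespace Literature.Probability.LatticeModels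

variable {V : Type*} {Ω : Type*} {mΩ : MeasurableSpace Ω}

/-! ### Perturbed partition functions, cell-set activities, local perturbations -/

section Defs

variable (μ : Measure Ω) (g : V → Ω → ℂ)

/-- The perturbed partition function of the finite cell set `C`:
`Z(C) = ∫ ∏_{p ∈ C} (1 + g p) dμ`. [cite: FriedliVelenik2017, §5.7.1] -/
def pertZ (C : Finset V) : ℂ := ∫ ω, ∏ p ∈ C, (1 + g p ω) ∂μ

/-- The activity of the finite cell set `K`: `M(K) = ∫ ∏_{p ∈ K} g p dμ`.
[cite: FriedliVelenik2017, §5.7.1] -/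
def cellActivity (K : Finset V) : ℂ := ∫ ω, ∏ p ∈ K, g p ω ∂μ

/-- The polymers of the expansion inside `C`: its nonempty `R`-connected subsets.
[cite: FriedliVelenik2017, §5.7.1] -/
def rconnSubsets (R : V → V → Prop) (C : Finset V) : Finset (Finset V) :=
  by classical exact C.powerset.filter fun X => IsRConnected R X

end Defs

/-- **Local perturbation of a finite-range dependent reference process.** Cells `p : V` carry
sub-σ-algebras `𝓕 p ≤ mΩ`; cell sets that do not touch (for the adjacency `R`) generate
independent σ-algebras; the cell factor `g p` is `𝓕 p`-measurable and bounded by `ε ≥ 0`.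
[cite: BauerschmidtBrydgesSlade2019, §3.3 (finite-range property ⇒ factorisation)] -/
structure IsLocalPerturbation (μ : Measure Ω) (R : V → V → Prop) (𝓕 : V → MeasurableSpace Ω)
    (g : V → Ω → ℂ) (ε : ℝ) : Prop where
  /-- the local σ-algebras are sub-σ-algebras of the ambient one -/
  le : ∀ p, 𝓕 p ≤ mΩ
  /-- finite-range dependence: non-touching cell sets generate independent σ-algebras -/
  indep : ∀ K₁ K₂ : Finset V, ¬ Touches R K₁ K₂ → Indep (⨆ p ∈ K₁, 𝓕 p) (⨆ p ∈ K₂, 𝓕 p) μ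
  /-- locality of the cell factors -/
  measurable : ∀ p, Measurable[𝓕 p] (g p)
  /-- smallness of the cell factors -/
  norm_le : ∀ p ω, ‖g p ω‖ ≤ ε
  /-- the bound is non-negative (automatic when `V` and `Ω` are nonempty) -/
  nonneg : 0 ≤ ε

namespace IsLocalPerturbation

variable {μ : Measure Ω} {R : V → V → Prop} {𝓕 : V → MeasurableSpace Ω} {g : V → Ω → ℂ} {ε : ℝ}

/-- Products of cell factors over `K ⊆ S` are measurable for the σ-algebra generated by the
cells of `S`. [folklore] -/
theorem measurable_prod_iSup (h : IsLocalPerturbation μ R 𝓕 g ε) {K S : Finset V} (hKS : K ⊆ S) :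
    Measurable[⨆ p ∈ S, 𝓕 p] fun ω => ∏ p ∈ K, g p ω :=
  Finset.measurable_prod (m := ⨆ p ∈ S, 𝓕 p) K fun p hp =>
    (h.measurable p).mono (le_iSup₂ (f := fun p (_ : p ∈ S) => 𝓕 p) p (hKS hp)) le_rfl

/-- The σ-algebra generated by finitely many cells is a sub-σ-algebra. [folklore] -/
theorem iSup_le (h : IsLocalPerturbation μ R 𝓕 g ε) (S : Finset V) : (⨆ p ∈ S, 𝓕 p) ≤ mΩ :=
  iSup₂_le fun p _ => h.le p

/-- Products of cell factors are measurable. [folklore] -/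
theorem measurable_prod (h : IsLocalPerturbation μ R 𝓕 g ε) (K : Finset V) :
    Measurable fun ω => ∏ p ∈ K, g p ω :=
  (h.measurable_prod_iSup (subset_refl K)).mono (h.iSup_le K) le_rfl

/-- Each cell factor is measurable. [folklore] -/
theorem measurable' (h : IsLocalPerturbation μ R 𝓕 g ε) (p : V) : Measurable (g p) :=
  (h.measurable p).mono (h.le p) le_rfl

/-- `‖∏_{p ∈ K} g p‖ ≤ ε^{#K}` pointwise. [folklore] -/
theorem norm_prod_le (h : IsLocalPerturbation μ R 𝓕 g ε) (K : Finset V) (ω : Ω) :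
    ‖∏ p ∈ K, g p ω‖ ≤ ε ^ K.card := by
  rw [norm_prod]
  calc ∏ p ∈ K, ‖g p ω‖ ≤ ∏ _p ∈ K, ε :=
        prod_le_prod (fun p _ => norm_nonneg _) fun p _ => h.norm_le p ω
    _ = ε ^ K.card := prod_const ε

/-- `‖∏_{p ∈ C} (1 + g p)‖ ≤ (1 + ε)^{#C}` pointwise. [folklore] -/
theorem norm_prod_one_add_le (h : IsLocalPerturbation μ R 𝓕 g ε) (C : Finset V) (ω : Ω) :
    ‖∏ p ∈ C, (1 + g p ω)‖ ≤ (1 + ε) ^ C.card := by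
  rw [norm_prod]
  calc ∏ p ∈ C, ‖1 + g p ω‖ ≤ ∏ _p ∈ C, (1 + ε) :=
        prod_le_prod (fun p _ => norm_nonneg _) fun p _ =>
          (norm_add_le _ _).trans (by rw [norm_one]; exact add_le_add le_rfl (h.norm_le p ω))
    _ = (1 + ε) ^ C.card := prod_const _

/-- Products of cell factors are integrable on a finite measure space. [folklore] -/
theorem integrable_prod [IsFiniteMeasure μ] (h : IsLocalPerturbation μ R 𝓕 g ε) (K : Finset V) :
    Integrable (fun ω => ∏ p ∈ K, g p ω) μ :=
  Integrable.of_bound (h.measurable_prod K).aestronglyMeasurable (ε ^ K.card)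
    (Filter.Eventually.of_forall (h.norm_prod_le K))

/-- The measurable product `∏_{p ∈ C} (1 + g p)`. [folklore] -/
theorem measurable_prod_one_add (h : IsLocalPerturbation μ R 𝓕 g ε) (C : Finset V) :
    Measurable fun ω => ∏ p ∈ C, (1 + g p ω) :=
  Finset.measurable_prod C fun p _ => measurable_const.add (h.measurable' p)

/-- `∏_{p ∈ C} (1 + g p)` is integrable on a finite measure space. [folklore] -/
theorem integrable_prod_one_add [IsFiniteMeasure μ] (h : IsLocalPerturbation μ R 𝓕 g ε)
    (C : Finset V) : Integrable (fun ω => ∏ p ∈ C, (1 + g p ω)) μ :=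
  Integrable.of_bound (h.measurable_prod_one_add C).aestronglyMeasurable ((1 + ε) ^ C.card)
    (Filter.Eventually.of_forall (h.norm_prod_one_add_le C))

/-- Scaling the cell factors by `t ∈ [-1, 1]` preserves the hypotheses (used along the ray
`t ↦ t • g`). [folklore] -/
theorem smul (h : IsLocalPerturbation μ R 𝓕 g ε) {t : ℝ} (ht : |t| ≤ 1) :
    IsLocalPerturbation μ R 𝓕 (fun p ω => (t : ℂ) * g p ω) ε where
  le := h.le
  indep := h.indep
  measurable p := (h.measurable p).const_mul (t : ℂ)
  norm_le p ω := by
    rw [norm_mul, Complex.norm_real, Real.norm_eq_abs]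
    calc |t| * ‖g p ω‖ ≤ 1 * ε := mul_le_mul ht (h.norm_le p ω) (norm_nonneg _) zero_le_one
      _ = ε := one_mul ε
  nonneg := h.nonneg

/-- **Product references.** If the cells carry finite sets of sites `verts p`, the site
σ-algebras `m a ≤ mΩ` are independent (`iIndep m μ`, e.g. the coordinates of a product measure),
`R` = sharing a site, and `𝓕 p = ⨆_{a ∈ verts p} m a`, then non-touching cell sets generate
independent σ-algebras. [cite: FriedliVelenik2017, §5.7.1 (product reference measure)] -/
theorem indep_of_iIndep {α : Type*} [DecidableEq α] {m : α → MeasurableSpace Ω}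
    (hm : ∀ a, m a ≤ mΩ) (hind : iIndep m μ) (verts : V → Finset α)
    (hne : ∀ p, (verts p).Nonempty) (K₁ K₂ : Finset V)
    (hK : ¬ Touches (ShareVertex verts) K₁ K₂) :
    Indep (⨆ p ∈ K₁, ⨆ a ∈ verts p, m a) (⨆ p ∈ K₂, ⨆ a ∈ verts p, m a) μ := by
  have hdisj : Disjoint (cellSupp verts K₁) (cellSupp verts K₂) :=
    disjoint_cellSupp_of_not_touches hne hK
  have h1 : (⨆ p ∈ K₁, ⨆ a ∈ verts p, m a) = ⨆ a ∈ cellSupp verts K₁, m a := by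
    unfold cellSupp; rw [Finset.iSup_biUnion]
  have h2 : (⨆ p ∈ K₂, ⨆ a ∈ verts p, m a) = ⨆ a ∈ cellSupp verts K₂, m a := by
    unfold cellSupp; rw [Finset.iSup_biUnion]
  rw [h1, h2]
  exact indep_iSup_of_disjoint (S := (cellSupp verts K₁ : Set α)) (T := (cellSupp verts K₂ : Set α))
    hm hind (Finset.disjoint_coe.2 hdisj)

end IsLocalPerturbation

/-! ### The expansion and the polymer representation -/

section Expansion

variable {μ : Measure Ω} {R : V → V → Prop} {𝓕 : V → MeasurableSpace Ω} {g : V → Ω → ℂ} {ε : ℝ}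

/-- Membership in `rconnSubsets`. [folklore] -/
theorem mem_rconnSubsets {C X : Finset V} : X ∈ rconnSubsets R C ↔ X ⊆ C ∧ IsRConnected R X := by
  classical
  unfold rconnSubsets
  rw [Finset.mem_filter, Finset.mem_powerset]

/-- Activities along the ray: `M_{t g}(K) = t^{#K} M_g(K)`. [folklore] -/
theorem cellActivity_smul (g : V → Ω → ℂ) (t : ℝ) (K : Finset V) :
    cellActivity μ (fun p ω => (t : ℂ) * g p ω) K = (t : ℂ) ^ K.card * cellActivity μ g K := by
  unfold cellActivity
  rw [← integral_const_mul]
  refine integral_congr_ae (Filter.Eventually.of_forall fun ω => ?_)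
  simp only [prod_mul_distrib, prod_const]

/-- `M(∅) = 1` on a probability space. [folklore] -/
theorem cellActivity_empty [IsProbabilityMeasure μ] (g : V → Ω → ℂ) :
    cellActivity μ g ∅ = 1 := by
  simp [cellActivity]

/-- `Z(∅) = 1` on a probability space. [folklore] -/
theorem pertZ_empty [IsProbabilityMeasure μ] (g : V → Ω → ℂ) : pertZ μ g ∅ = 1 := by
  simp [pertZ]

/-- **Activity bound** `‖M(K)‖ ≤ ε^{#K}` on a probability space. [cite: FriedliVelenik2017, §5.7.1] -/
theorem norm_cellActivity_le [IsProbabilityMeasure μ] (h : IsLocalPerturbation μ R 𝓕 g ε)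
    (K : Finset V) : ‖cellActivity μ g K‖ ≤ ε ^ K.card := by
  have := norm_integral_le_of_norm_le_const (μ := μ) (f := fun ω => ∏ p ∈ K, g p ω)
    (C := ε ^ K.card) (Filter.Eventually.of_forall (h.norm_prod_le K))
  rwa [probReal_univ, mul_one] at this

/-- **Expanding the product**: `Z(C) = Σ_{K ⊆ C} M(K)`. [cite: FriedliVelenik2017, §5.7.1] -/
theorem pertZ_eq_sum_cellActivity [IsFiniteMeasure μ] (h : IsLocalPerturbation μ R 𝓕 g ε)
    (C : Finset V) : pertZ μ g C = ∑ K ∈ C.powerset, cellActivity μ g K := by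
  unfold pertZ cellActivity
  simp_rw [Finset.prod_one_add]
  exact integral_finsetSum _ fun K _ => h.integrable_prod K

variable [DecidableEq V]

/-- **Factorisation over non-touching cell sets** (finite-range dependence):
`M(K₁ ∪ K₂) = M(K₁) M(K₂)` when `K₁, K₂` do not touch.
[cite: BauerschmidtBrydgesSlade2019, §3.3] -/
theorem cellActivity_union (h : IsLocalPerturbation μ R 𝓕 g ε) {K₁ K₂ : Finset V}
    (hK : ¬ Touches R K₁ K₂) :
    cellActivity μ g (K₁ ∪ K₂) = cellActivity μ g K₁ * cellActivity μ g K₂ := by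
  have hdisj : Disjoint K₁ K₂ :=
    Finset.disjoint_left.2 fun p hp1 hp2 => hK ⟨p, hp1, p, hp2, Or.inl rfl⟩
  unfold cellActivity
  simp_rw [Finset.prod_union hdisj]
  have hX := h.measurable_prod_iSup (subset_refl K₁)
  have hY := h.measurable_prod_iSup (subset_refl K₂)
  have hind : IndepFun (fun ω => ∏ p ∈ K₁, g p ω) (fun ω => ∏ p ∈ K₂, g p ω) μ := by
    rw [IndepFun_iff_Indep]
    exact indep_of_indep_of_le_right (indep_of_indep_of_le_left (h.indep K₁ K₂ hK) hX.comap_le)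
      hY.comap_le
  exact hind.integral_mul_eq_mul_integral (h.measurable_prod K₁).aestronglyMeasurable
    (h.measurable_prod K₂).aestronglyMeasurable

/-- **The polymer representation**: `Z(C) = Ξ(𝒫(C); M)`, the partition function of the
hard-core gas of nonempty `R`-connected subsets of `C` with the geometric incompatibility and
activity `M`. [cite: FriedliVelenik2017, §5.2 and §5.7.1] -/
theorem pertZ_eq_polymerPartitionFunction [IsProbabilityMeasure μ] [DecidableRel R]
    (hR : ∀ x y, R x y → R y x) (h : IsLocalPerturbation μ R 𝓕 g ε) (C : Finset V) :
    pertZ μ g C = polymerPartitionFunction (GeomInc R) (cellActivity μ g) (rconnSubsets R C) := by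
  rw [pertZ_eq_sum_cellActivity h C]
  exact sum_powerset_eq_polymerPartitionFunction_of_mul hR _ (cellActivity_empty g)
    (fun K₁ K₂ hK => cellActivity_union h hK) C

end Expansion

/-! ### Dobrushin's criterion: zero-freeness and the exclusion cost -/

section Dobrushin

variable [DecidableEq V] {μ : Measure Ω} {R : V → V → Prop} [DecidableRel R] {𝓕 : V → MeasurableSpace Ω}
  {g : V → Ω → ℂ} {ε : ℝ} {nbr : V → Finset V} {Δ : ℕ}

/-- The activity truncated to connected sets (the polymer functional of the gas). [folklore] -/
def connActivity (R : V → V → Prop) (μ : Measure Ω) (g : V → Ω → ℂ) (X : Finset V) : ℂ :=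
  by classical exact if IsRConnected R X then cellActivity μ g X else 0

/-- On families of connected sets the truncation is invisible. [folklore] -/
theorem polymerPartitionFunction_connActivity {𝒜 : Finset (Finset V)}
    (h𝒜 : ∀ X ∈ 𝒜, IsRConnected R X) :
    polymerPartitionFunction (GeomInc R) (connActivity R μ g) 𝒜 =
      polymerPartitionFunction (GeomInc R) (cellActivity μ g) 𝒜 :=
  polymerPartitionFunction_congr fun X hX => by simp [connActivity, h𝒜 X hX]

/-- Dobrushin's hypothesis for the truncated activities (the tree's `geomInc_dobrushin`).
[cite: Dobrushin1996, §2] -/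
theorem connActivity_dobrushin [IsProbabilityMeasure μ] (hR : ∀ x y, R x y → R y x)
    (hΔ : ∀ x, (nbr x).card ≤ Δ) (hnbr : ∀ x y, R x y → y ∈ nbr x)
    (h : IsLocalPerturbation μ R 𝓕 g ε) (hsmall : Real.exp 1 * ε * ((Δ : ℝ) + 1) ^ 2 ≤ 1 / 2)
    (X : Finset V) (N : Finset (Finset V)) (hN : ∀ Y ∈ N, GeomInc R X Y) :
    ‖connActivity R μ g X‖ * ∏ Y ∈ N, (1 + kpWeight R (Real.exp 1 * ε) Y) ≤
      kpWeight R (Real.exp 1 * ε) X :=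
  geomInc_dobrushin hR hΔ hnbr h.nonneg hsmall _ (fun X hX => by simp [connActivity, hX])
    (fun X => by
      by_cases hX : IsRConnected R X
      · simpa [connActivity, hX] using norm_cellActivity_le h X
      · simp only [connActivity, hX, if_false, norm_zero]
        exact pow_nonneg h.nonneg _) X N hN

/-- **Zero-freeness**: under `e ε (Δ + 1)² ≤ 1/2`, `Z(C) ≠ 0` for every finite cell set `C`.
[cite: FriedliVelenik2017, Thm. 5.4 and §5.7.1; Dobrushin1996] -/
theorem pertZ_ne_zero [IsProbabilityMeasure μ] (hR : ∀ x y, R x y → R y x)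
    (hΔ : ∀ x, (nbr x).card ≤ Δ) (hnbr : ∀ x y, R x y → y ∈ nbr x)
    (h : IsLocalPerturbation μ R 𝓕 g ε) (hsmall : Real.exp 1 * ε * ((Δ : ℝ) + 1) ^ 2 ≤ 1 / 2)
    (C : Finset V) : pertZ μ g C ≠ 0 := by
  rw [pertZ_eq_polymerPartitionFunction hR h C,
    ← polymerPartitionFunction_connActivity fun X hX => (mem_rconnSubsets.1 hX).2]
  exact (polymerPartitionFunction_ne_zero_and_ratio_le (inc := GeomInc R) (geomInc_refl R)
    (fun X Y hXY => geomInc_symm R hR hXY) _ _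
    (kpWeight_nonneg R (mul_nonneg (Real.exp_pos 1).le h.nonneg))
    (connActivity_dobrushin hR hΔ hnbr h hsmall) _).1

omit [DecidableRel R] in
/-- Removing the cells of `D` removes exactly the polymers meeting `D`. [folklore] -/
theorem rconnSubsets_sdiff (C D : Finset V) :
    rconnSubsets R (C \ D) =
      rconnSubsets R C \ (rconnSubsets R C).filter fun X => (X ∩ D).Nonempty := by
  ext X
  simp only [mem_sdiff, mem_filter, mem_rconnSubsets, Finset.subset_sdiff]
  constructor
  · rintro ⟨⟨hXC, hXD⟩, hc⟩
    refine ⟨⟨hXC, hc⟩, fun h => ?_⟩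
    obtain ⟨q, hq⟩ := h.2
    exact Finset.disjoint_left.1 hXD (mem_inter.1 hq).1 (mem_inter.1 hq).2
  · rintro ⟨⟨hXC, hc⟩, hn⟩
    exact ⟨⟨hXC, Finset.disjoint_left.2 fun q hqX hqD =>
      hn ⟨⟨hXC, hc⟩, q, mem_inter.2 ⟨hqX, hqD⟩⟩⟩, hc⟩

/-- **The exclusion cost is volume-uniform**: under `e ε (Δ + 1)² ≤ 1/2`,
`‖Z(C ∖ D) / Z(C)‖ ≤ exp (#D · (Δ + 1) · 2 e ε)` for all finite `C, D` (telescoped Dobrushin ratios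
over the polymers meeting `D`, whose total weight is at most `#D (Δ+1) 2eε`).
[cite: FriedliVelenik2017, §5.7.1; Dobrushin1996] -/
theorem norm_pertZ_sdiff_div_le [IsProbabilityMeasure μ] (hR : ∀ x y, R x y → R y x)
    (hΔ : ∀ x, (nbr x).card ≤ Δ) (hnbr : ∀ x y, R x y → y ∈ nbr x)
    (h : IsLocalPerturbation μ R 𝓕 g ε) (hsmall : Real.exp 1 * ε * ((Δ : ℝ) + 1) ^ 2 ≤ 1 / 2)
    (C D : Finset V) :
    ‖pertZ μ g (C \ D) / pertZ μ g C‖ ≤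
      Real.exp (D.card * ((Δ : ℝ) + 1) * (2 * (Real.exp 1 * ε))) := by
  set lam : ℝ := Real.exp 1 * ε with hlam_def
  have hlam : 0 ≤ lam := mul_nonneg (Real.exp_pos 1).le h.nonneg
  have hsmall' : ((Δ : ℝ) + 1) ^ 2 * lam ≤ 1 / 2 := by rw [hlam_def]; linarith [hsmall]
  set M : Finset (Finset V) := (rconnSubsets R C).filter fun X => (X ∩ D).Nonempty with hM
  rw [pertZ_eq_polymerPartitionFunction hR h C, pertZ_eq_polymerPartitionFunction hR h (C \ D),
    rconnSubsets_sdiff C D,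
    ← polymerPartitionFunction_connActivity fun X hX => (mem_rconnSubsets.1 hX).2,
    ← polymerPartitionFunction_connActivity fun X hX => (mem_rconnSubsets.1 (mem_sdiff.1 hX).1).2]
  refine (norm_polymerPartitionFunction_sdiff_div_le_exp (inc := GeomInc R) (geomInc_refl R)
    (fun X Y hXY => geomInc_symm R hR hXY) _ _ (kpWeight_nonneg R hlam)
    (connActivity_dobrushin hR hΔ hnbr h hsmall) (rconnSubsets R C) M).trans ?_
  refine Real.exp_le_exp.2 (sum_kpWeight_le_of_touches hR hΔ hnbr hlam hsmall' D M fun Y hY => ?_)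
  obtain ⟨q, hq⟩ := (mem_filter.1 hY).2
  exact Or.inr ⟨q, (mem_inter.1 hq).2, q, (mem_inter.1 hq).1, Or.inl rfl⟩

/-- In particular `‖Z(C ∖ D)‖ ≤ exp (#D (Δ+1) 2eε) ‖Z(C)‖`. [folklore] -/
theorem norm_pertZ_sdiff_le [IsProbabilityMeasure μ] (hR : ∀ x y, R x y → R y x)
    (hΔ : ∀ x, (nbr x).card ≤ Δ) (hnbr : ∀ x y, R x y → y ∈ nbr x)
    (h : IsLocalPerturbation μ R 𝓕 g ε) (hsmall : Real.exp 1 * ε * ((Δ : ℝ) + 1) ^ 2 ≤ 1 / 2)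
    (C D : Finset V) :
    ‖pertZ μ g (C \ D)‖ ≤
      Real.exp (D.card * ((Δ : ℝ) + 1) * (2 * (Real.exp 1 * ε))) * ‖pertZ μ g C‖ := by
  have hne := pertZ_ne_zero hR hΔ hnbr h hsmall C
  have := norm_pertZ_sdiff_div_le hR hΔ hnbr h hsmall C D
  rw [norm_div, div_le_iff₀ (norm_pos_iff.2 hne)] at this
  exact this

end Dobrushin

end Literature.Probability.LatticeModels
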